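import Summits.NavierStokesRegularity.NavierStokesRegularity.Theorems.OddMorawetzOddMorawetzLocalEPolySemantics
import Summits.NavierStokesRegularity.NavierStokesRegularity.Theorems.OddMorawetzOrderThreeIndefiniteValue
import HarnessLib

/-!
# Crux `OddMorawetzLocal` (stmt-NavierStokesRegularity-1376), refutation — evaluator soundness 2/4: Hermite data

Stub `hermExp_sound` of the refutation skeleton.  Pure list algebra over Mathlib, the tree's `pev`/`dgList`/`pairs`/
`hermVal`/`polyE` vocabulary (`OddMorawetzDefs`) and the `EPoly` semantics (`toP3_dgList`, `toP3_norm`,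
`toP3_append`, `toP3_smul` of `…EPolySemantics`); no named facts.

The landed `pairing_value` turns the Morawetz pairing `∫ ⟪B(v,v), pgv 2 Q⟫` of a polynomial-Gaussian field into
explicit moment sums GIVEN four data identities: Hermite expansions of `div W` and `div G` as `toLW`-lists of tree
Hermite elements `D^{pairs ps} 1`, and even monomial expansions (`polyE`) of the local product and of the product of
the two Hermite symbols.  The kernel evaluator (`OddMorawetzLocalEvaluatorDefs`) produces that data by the fuelled
elimination `EPoly.hermExp` and the conversions `toLW`, `toMloc`, `toMfour`.  This file proves:

* `toP3_he_even` — for even `e`, `he e = dgList 2 (dirList e) 1` represents `D^{pairs (halfList e)} 1`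
  (`pairs (halfList e) = dirList e`);
* `toP3_hermExp` — soundness of the elimination by induction on the fuel: if the remainder is empty then
  `q = Σ d_e · he e` over the returned coefficient list (no degree argument is needed: each step subtracts exactly
  what it records);
* `pev_hermSum_eq_toLW`, `pev_toP3_eq_polyE`, `hermVal_toLW_mul` — the parity conversions to `pairing_value`'s data
  format (`(-(4π²ξⱼ²))^a = (-4)^a π^{2a} ξⱼ^{2a}` and the double sum over `A × B` in `flatMap`/`map` form);
* `mloc_sum_eq`, `mfour_sum_eq` — the Gaussian (rate `4`) and Riesz–Gaussian moment sums of the converted data are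
  `locMoment M · π√π` and `rieszPair A B · √π` (termwise `push_cast`/`field_simp`; `π^{2n}/π^{2n} = 1` by
  parity);
* `hermExp_sound` — the registered seven-part conjunction.
-/

noncomputable section

set_option linter.dupNamespace false
set_option autoImplicit false

namespace Summit.NavierStokesRegularity.NavierStokesRegularity.Theorems.OddMorawetz

open MvPolynomial

/-! ### Part 1: Hermite polynomials of even order -/

/-- `pairs` is a monoid morphism on lists: `pairs (l₁ ++ l₂) = pairs l₁ ++ pairs l₂`. -/
theorem pairs_append (l₁ l₂ : List (Fin 3)) : pairs (l₁ ++ l₂) = pairs l₁ ++ pairs l₂ := by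
  simp [pairs, List.flatMap_append]

/-- Doubling a constant list doubles its length: `pairs (replicate n j) = replicate (2n) j`. -/
theorem pairs_replicate (n : ℕ) (j : Fin 3) : pairs (List.replicate n j) = List.replicate (2 * n) j := by
  induction n with
  | zero => rfl
  | succ n ih =>
    rw [List.replicate_succ, pairs_cons, ih, show 2 * (n + 1) = (2 * n + 1) + 1 by ring,
      List.replicate_succ, List.replicate_succ]

/-- For an even exponent triple, doubling the halved direction list gives back the direction list. -/
theorem pairs_halfList (e : ℕ × ℕ × ℕ) (h0 : e.1 % 2 = 0) (h1 : e.2.1 % 2 = 0) (h2 : e.2.2 % 2 = 0) :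
    pairs (halfList e) = EPoly.dirList e := by
  have e0 : 2 * (e.1 / 2) = e.1 := by omega
  have e1 : 2 * (e.2.1 / 2) = e.2.1 := by omega
  have e2 : 2 * (e.2.2 / 2) = e.2.2 := by omega
  simp only [halfList, EPoly.dirList, pairs_append, pairs_replicate, e0, e1, e2]

/-- **Part 1.** For an even exponent triple `e`, the kernel's Hermite polynomial `he e` represents the tree's
Hermite element `D^{pairs (halfList e)} 1` at Gaussian rate `2`. -/
theorem toP3_he_even (e : ℕ × ℕ × ℕ) (h0 : e.1 % 2 = 0) (h1 : e.2.1 % 2 = 0) (h2 : e.2.2 % 2 = 0) :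
    EPoly.toP3 (EPoly.he e) = dgList 2 (pairs (halfList e)) 1 := by
  rw [pairs_halfList e h0 h1 h2, EPoly.he, toP3_dgList]
  congr 1
  simp [EPoly.toP3]

/-! ### Part 2: soundness of the fuelled elimination -/

/-- `maxMono` returns `none` only on the empty list. -/
theorem eq_nil_of_maxMono_eq_none {l : EPoly} (h : EPoly.maxMono l = none) : l = [] := by
  cases l with
  | nil => rfl
  | cons t p =>
    simp only [EPoly.maxMono] at h
    split at h
    · simp at h
    · split at h <;> simp at h

/-- **Part 2.** Soundness of the fuelled Hermite elimination: when the remainder is empty, the polynomial is the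
combination of Hermite polynomials with the returned coefficients (whatever the coefficients are). -/
theorem toP3_hermExp (fuel : ℕ) (q : EPoly) (h : (EPoly.hermExp fuel q).2 = []) :
    EPoly.toP3 q = ((EPoly.hermExp fuel q).1.map fun t => C (t.1 : ℝ) * EPoly.toP3 (EPoly.he t.2)).sum := by
  induction fuel generalizing q with
  | zero =>
    simp only [EPoly.hermExp] at h ⊢
    rw [← toP3_norm q, h]
    simp [EPoly.toP3]
  | succ fuel ih =>
    simp only [EPoly.hermExp] at h ⊢
    rcases hm : EPoly.maxMono (EPoly.norm q) with _ | ⟨c, e⟩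
    · have hq : EPoly.norm q = [] := eq_nil_of_maxMono_eq_none hm
      simp only [hm] at h ⊢
      rw [← toP3_norm q, hq]
      simp [EPoly.toP3]
    · simp only [hm] at h ⊢
      have key := ih _ h
      rw [toP3_append, toP3_norm, toP3_smul] at key
      simp only [List.map_cons, List.sum_cons]
      rw [← key]
      simp only [Rat.cast_neg, map_neg]
      ring

/-! ### Part 3: the Hermite combination in `toLW` form -/

/-- Unfolding `allEven` on a cons. -/
theorem allEven_cons_iff (t : ℚ × ℕ × ℕ × ℕ) (L : List (ℚ × ℕ × ℕ × ℕ)) :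
    EPoly.allEven (t :: L) = true ↔
      (t.2.1 % 2 = 0 ∧ t.2.2.1 % 2 = 0 ∧ t.2.2.2 % 2 = 0) ∧ EPoly.allEven L = true := by
  simp only [EPoly.allEven, List.all_cons, Bool.and_eq_true, beq_iff_eq, and_assoc]

/-- Members of an `allEven` list have even exponents. -/
theorem even_of_mem_allEven {L : List (ℚ × ℕ × ℕ × ℕ)} (h : EPoly.allEven L = true)
    (t : ℚ × ℕ × ℕ × ℕ) (ht : t ∈ L) : t.2.1 % 2 = 0 ∧ t.2.2.1 % 2 = 0 ∧ t.2.2.2 % 2 = 0 := by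
  have := List.all_eq_true.1 h t ht
  simpa [Bool.and_eq_true, beq_iff_eq, and_assoc] using this

/-- **Part 3.** The Hermite combination of an even coefficient list, evaluated, is the `toLW`-sum of tree Hermite
elements `D^{pairs ps} 1`. -/
theorem pev_hermSum_eq_toLW (L : List (ℚ × ℕ × ℕ × ℕ)) (hL : EPoly.allEven L = true) (x : E3) :
    pev ((L.map fun t => C (t.1 : ℝ) * EPoly.toP3 (EPoly.he t.2)).sum) x =
      ((toLW L).map fun dl => dl.1 * pev (dgList 2 (pairs dl.2) 1) x).sum := by
  induction L with
  | nil => simp [toLW]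
  | cons t L ih =>
    obtain ⟨⟨h0, h1, h2⟩, hL'⟩ := (allEven_cons_iff t L).1 hL
    simp only [toLW, List.map_cons, List.sum_cons, pev_add, pev_mul, pev_C] at ih ⊢
    rw [ih hL', toP3_he_even t.2 h0 h1 h2]

/-! ### Part 4: even polynomials as `polyE` lists -/

/-- **Part 4.** An even kernel polynomial, evaluated, is the `polyE` of its halved-exponent list. -/
theorem pev_toP3_eq_polyE (M : EPoly) (hM : EPoly.allEven M = true) (x : E3) :
    pev (EPoly.toP3 M) x = polyE (toMloc M) x := by
  induction M with
  | nil => simp [EPoly.toP3, toMloc]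
  | cons t M ih =>
    obtain ⟨⟨h0, h1, h2⟩, hM'⟩ := (allEven_cons_iff t M).1 hM
    have e0 : 2 * (t.2.1 / 2) = t.2.1 := by omega
    have e1 : 2 * (t.2.2.1 / 2) = t.2.2.1 := by omega
    have e2 : 2 * (t.2.2.2 / 2) = t.2.2.2 := by omega
    simp only [EPoly.toP3, toMloc, List.map_cons, List.sum_cons, pev_add, pev_mul, pev_C, pev_pow, pev_X,
      polyE_cons] at ih ⊢
    rw [ih hM', e0, e1, e2]

/-! ### Part 5: the product of two Hermite symbols -/

/-- Powers of a Hermite symbol factor: `(-(4π²y²))^a = (-4)^a π^{2a} y^{2a}`. -/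
theorem neg_four_pi_sq_pow (y : ℝ) (a : ℕ) :
    (-(4 * Real.pi ^ 2 * y ^ 2)) ^ a = (-4 : ℝ) ^ a * Real.pi ^ (2 * a) * y ^ (2 * a) := by
  induction a with
  | zero => simp
  | succ a ih => rw [pow_succ, ih]; ring

/-- The Hermite symbol of a doubled exponent triple. -/
theorem prod_halfList_two (a0 a1 a2 : ℕ) (ξ : E3) :
    ((halfList (2 * a0, 2 * a1, 2 * a2)).map fun j => -(4 * Real.pi ^ 2 * ξ j ^ 2)).prod =
      (-4 : ℝ) ^ (a0 + a1 + a2) * Real.pi ^ (2 * (a0 + a1 + a2)) *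
        (ξ 0 ^ (2 * a0) * ξ 1 ^ (2 * a1) * ξ 2 ^ (2 * a2)) := by
  have e0 : 2 * a0 / 2 = a0 := by omega
  have e1 : 2 * a1 / 2 = a1 := by omega
  have e2 : 2 * a2 / 2 = a2 := by omega
  simp only [halfList, e0, e1, e2, List.map_append, List.map_replicate, List.prod_append, List.prod_replicate,
    neg_four_pi_sq_pow]
  ring

/-- `hermVal (toLW A)` as a sum over `A`. -/
theorem hermVal_toLW (A : List (ℚ × ℕ × ℕ × ℕ)) (ξ : E3) :
    hermVal (toLW A) ξ =
      (A.map fun s => (s.1 : ℝ) * ((halfList s.2).map fun j => -(4 * Real.pi ^ 2 * ξ j ^ 2)).prod).sum := by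
  induction A with
  | nil => rfl
  | cons s A ih => simp only [toLW, List.map_cons, List.sum_cons, hermVal_cons] at ih ⊢; rw [ih]

/-- Product of two list sums as the sum over the product list (in `flatMap`/`map` form). -/
theorem sum_map_mul_sum_map {α β : Type*} (A : List α) (B : List β) (f : α → ℝ) (g : β → ℝ) :
    (A.map f).sum * (B.map g).sum = (A.flatMap fun s => B.map fun t => f s * g t).sum := by
  induction A with
  | nil => simp
  | cons a A ih => simp [List.flatMap_cons, List.sum_append, add_mul, ih, List.sum_map_mul_left]

/-- Termwise congruence of a double list sum, with membership. -/
theorem sum_flatMap_map_congr {α β : Type*} (A : List α) (B : List β) (f g : α → β → ℝ)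
    (h : ∀ s ∈ A, ∀ t ∈ B, f s t = g s t) :
    (A.flatMap fun s => B.map fun t => f s t).sum = (A.flatMap fun s => B.map fun t => g s t).sum := by
  induction A with
  | nil => rfl
  | cons a A ih =>
    simp only [List.flatMap_cons, List.sum_append]
    rw [ih (fun s hs => h s (List.mem_cons_of_mem a hs)),
      List.map_congr_left (fun t ht => h a (by simp) t ht)]

/-- **Part 5.** The product of the Hermite symbols of two even coefficient lists is the even polynomial
`polyE (toMfour A B)`. -/
theorem hermVal_toLW_mul (A B : List (ℚ × ℕ × ℕ × ℕ)) (hA : EPoly.allEven A = true)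
    (hB : EPoly.allEven B = true) (ξ : E3) :
    hermVal (toLW A) ξ * hermVal (toLW B) ξ = polyE (toMfour A B) ξ := by
  rw [hermVal_toLW, hermVal_toLW, sum_map_mul_sum_map]
  simp only [polyE, toMfour, List.map_flatMap, List.map_map, Function.comp_def]
  apply sum_flatMap_map_congr
  intro s hs t ht
  obtain ⟨hs0, hs1, hs2⟩ := even_of_mem_allEven hA s hs
  obtain ⟨ht0, ht1, ht2⟩ := even_of_mem_allEven hB t ht
  obtain ⟨c, s0, s1, s2⟩ := s
  obtain ⟨d, t0, t1, t2⟩ := t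
  simp only at hs0 hs1 hs2 ht0 ht1 ht2 ⊢
  obtain ⟨a0, rfl⟩ : ∃ a, s0 = 2 * a := ⟨s0 / 2, by omega⟩
  obtain ⟨a1, rfl⟩ : ∃ a, s1 = 2 * a := ⟨s1 / 2, by omega⟩
  obtain ⟨a2, rfl⟩ : ∃ a, s2 = 2 * a := ⟨s2 / 2, by omega⟩
  obtain ⟨b0, rfl⟩ : ∃ b, t0 = 2 * b := ⟨t0 / 2, by omega⟩
  obtain ⟨b1, rfl⟩ : ∃ b, t1 = 2 * b := ⟨t1 / 2, by omega⟩
  obtain ⟨b2, rfl⟩ : ∃ b, t2 = 2 * b := ⟨t2 / 2, by omega⟩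
  rw [prod_halfList_two, prod_halfList_two]
  have en : (EPoly.tdeg (2 * a0, 2 * a1, 2 * a2) + EPoly.tdeg (2 * b0, 2 * b1, 2 * b2)) / 2 =
      a0 + a1 + a2 + (b0 + b1 + b2) := by
    simp only [EPoly.tdeg]; omega
  have f0 : (2 * a0 + 2 * b0) / 2 = a0 + b0 := by omega
  have f1 : (2 * a1 + 2 * b1) / 2 = a1 + b1 := by omega
  have f2 : (2 * a2 + 2 * b2) / 2 = a2 + b2 := by omega
  rw [en, f0, f1, f2]
  push_cast
  ring

/-! ### Part 6: the local Gaussian moment sum -/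

/-- **Part 6.** The rate-4 Gaussian moments of `toMloc M` sum to `locMoment M · π√π`. -/
theorem mloc_sum_eq (M : EPoly) :
    ((toMloc M).map fun t => t.1 *
        (((2 * t.2.1 - 1).doubleFactorial * (2 * t.2.2.1 - 1).doubleFactorial *
            (2 * t.2.2.2 - 1).doubleFactorial : ℝ) *
          (Real.pi * Real.sqrt Real.pi / (8 ^ (t.2.1 + t.2.2.1 + t.2.2.2) * 8)))).sum =
      (EPoly.locMoment M : ℝ) * (Real.pi * Real.sqrt Real.pi) := by
  induction M with
  | nil => simp [toMloc, EPoly.locMoment]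
  | cons t M ih =>
    simp only [toMloc, EPoly.locMoment, List.map_cons, List.sum_cons] at ih ⊢
    rw [ih]
    simp only [EPoly.dfOdd]
    push_cast
    ring

/-! ### Part 7: the Riesz–Gaussian moment sum -/

/-- A double list sum whose terms are rational multiples of a fixed real number. -/
theorem sum_flatMap_map_eq_cast_mul {α β : Type*} (A : List α) (B : List β) (F : α → β → ℝ)
    (q : α → β → ℚ) (r : ℝ) (h : ∀ s ∈ A, ∀ t ∈ B, F s t = (q s t : ℝ) * r) :
    (A.flatMap fun s => B.map fun t => F s t).sum =
      (((A.flatMap fun s => B.map fun t => q s t).sum : ℚ) : ℝ) * r := by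
  induction A with
  | nil => simp
  | cons a A ih =>
    simp only [List.flatMap_cons, List.sum_append]
    rw [ih (fun s hs => h s (List.mem_cons_of_mem a hs)),
      List.map_congr_left (fun t ht => h a (by simp) t ht)]
    push_cast
    rw [add_mul, List.sum_map_mul_right, List.map_map]
    rfl

/-- **Part 7.** The Riesz–Gaussian moments of `toMfour A B` sum to `rieszPair A B · √π` (even lists). -/
theorem mfour_sum_eq (A B : List (ℚ × ℕ × ℕ × ℕ)) (hA : EPoly.allEven A = true)
    (hB : EPoly.allEven B = true) :
    ((toMfour A B).map fun t => t.1 *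
        (((2 * t.2.1 - 1).doubleFactorial * (2 * t.2.2.1 - 1).doubleFactorial *
            (2 * t.2.2.2 - 1).doubleFactorial : ℝ) *
          (2 / ((2 * (t.2.1 + t.2.2.1 + t.2.2.2 : ℕ) + 1) * 2 ^ (t.2.1 + t.2.2.1 + t.2.2.2))) *
            (Real.sqrt Real.pi / Real.pi ^ (2 * (t.2.1 + t.2.2.1 + t.2.2.2))))).sum =
      (EPoly.rieszPair A B : ℝ) * Real.sqrt Real.pi := by
  simp only [toMfour, EPoly.rieszPair, List.map_flatMap, List.map_map, Function.comp_def]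
  apply sum_flatMap_map_eq_cast_mul
  intro s hs t ht
  obtain ⟨hs0, hs1, hs2⟩ := even_of_mem_allEven hA s hs
  obtain ⟨ht0, ht1, ht2⟩ := even_of_mem_allEven hB t ht
  obtain ⟨c, s0, s1, s2⟩ := s
  obtain ⟨d, t0, t1, t2⟩ := t
  simp only at hs0 hs1 hs2 ht0 ht1 ht2 ⊢
  obtain ⟨a0, rfl⟩ : ∃ a, s0 = 2 * a := ⟨s0 / 2, by omega⟩
  obtain ⟨a1, rfl⟩ : ∃ a, s1 = 2 * a := ⟨s1 / 2, by omega⟩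
  obtain ⟨a2, rfl⟩ : ∃ a, s2 = 2 * a := ⟨s2 / 2, by omega⟩
  obtain ⟨b0, rfl⟩ : ∃ b, t0 = 2 * b := ⟨t0 / 2, by omega⟩
  obtain ⟨b1, rfl⟩ : ∃ b, t1 = 2 * b := ⟨t1 / 2, by omega⟩
  obtain ⟨b2, rfl⟩ : ∃ b, t2 = 2 * b := ⟨t2 / 2, by omega⟩
  have en : (EPoly.tdeg (2 * a0, 2 * a1, 2 * a2) + EPoly.tdeg (2 * b0, 2 * b1, 2 * b2)) / 2 =
      a0 + b0 + (a1 + b1) + (a2 + b2) := by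
    simp only [EPoly.tdeg]; omega
  have f0 : (2 * a0 + 2 * b0) / 2 = a0 + b0 := by omega
  have f1 : (2 * a1 + 2 * b1) / 2 = a1 + b1 := by omega
  have f2 : (2 * a2 + 2 * b2) / 2 = a2 + b2 := by omega
  rw [en, f0, f1, f2]
  have hπ : Real.pi ^ (2 * (a0 + b0 + (a1 + b1) + (a2 + b2))) ≠ 0 := pow_ne_zero _ Real.pi_ne_zero
  have hN :
      (2 * ((a0 + b0 + (a1 + b1) + (a2 + b2) : ℕ) : ℝ) + 1) * 2 ^ (a0 + b0 + (a1 + b1) + (a2 + b2)) ≠ 0 := by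
    positivity
  simp only [EPoly.dfOdd]
  push_cast
  field_simp

/-! ### Assembly -/

/-- **Stub `hermExp_sound`** (refutation of `OddMorawetzLocal`, evaluator soundness 2/4): the kernel's Hermite
data and its conversions satisfy the four data identities of `pairing_value`, and the moment sums collapse to
`locMoment · π√π` and `rieszPair · √π`. -/
theorem hermExp_sound :
    (∀ e : ℕ × ℕ × ℕ, e.1 % 2 = 0 → e.2.1 % 2 = 0 → e.2.2 % 2 = 0 →
      EPoly.toP3 (EPoly.he e) = dgList 2 (pairs (halfList e)) 1) ∧
    (∀ (fuel : ℕ) (q : EPoly), (EPoly.hermExp fuel q).2 = [] →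
      EPoly.toP3 q = ((EPoly.hermExp fuel q).1.map fun t => C (t.1 : ℝ) * EPoly.toP3 (EPoly.he t.2)).sum) ∧
    (∀ (L : List (ℚ × ℕ × ℕ × ℕ)), EPoly.allEven L = true → ∀ x : E3,
      pev ((L.map fun t => C (t.1 : ℝ) * EPoly.toP3 (EPoly.he t.2)).sum) x =
        ((toLW L).map fun dl => dl.1 * pev (dgList 2 (pairs dl.2) 1) x).sum) ∧
    (∀ M : EPoly, EPoly.allEven M = true → ∀ x : E3, pev (EPoly.toP3 M) x = polyE (toMloc M) x) ∧
    (∀ A B : List (ℚ × ℕ × ℕ × ℕ), EPoly.allEven A = true → EPoly.allEven B = true → ∀ ξ : E3,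
      hermVal (toLW A) ξ * hermVal (toLW B) ξ = polyE (toMfour A B) ξ) ∧
    (∀ M : EPoly, ((toMloc M).map fun t => t.1 *
        (((2 * t.2.1 - 1).doubleFactorial * (2 * t.2.2.1 - 1).doubleFactorial *
            (2 * t.2.2.2 - 1).doubleFactorial : ℝ) *
          (Real.pi * Real.sqrt Real.pi / (8 ^ (t.2.1 + t.2.2.1 + t.2.2.2) * 8)))).sum =
        (EPoly.locMoment M : ℝ) * (Real.pi * Real.sqrt Real.pi)) ∧
    (∀ A B : List (ℚ × ℕ × ℕ × ℕ), EPoly.allEven A = true → EPoly.allEven B = true →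
      ((toMfour A B).map fun t => t.1 *
        (((2 * t.2.1 - 1).doubleFactorial * (2 * t.2.2.1 - 1).doubleFactorial *
            (2 * t.2.2.2 - 1).doubleFactorial : ℝ) *
          (2 / ((2 * (t.2.1 + t.2.2.1 + t.2.2.2 : ℕ) + 1) * 2 ^ (t.2.1 + t.2.2.1 + t.2.2.2))) *
            (Real.sqrt Real.pi / Real.pi ^ (2 * (t.2.1 + t.2.2.1 + t.2.2.2))))).sum =
        (EPoly.rieszPair A B : ℝ) * Real.sqrt Real.pi) :=
  ⟨toP3_he_even, toP3_hermExp, pev_hermSum_eq_toLW, pev_toP3_eq_polyE, hermVal_toLW_mul, mloc_sum_eq,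
    mfour_sum_eq⟩

end Summit.NavierStokesRegularity.NavierStokesRegularity.Theorems.OddMorawetz
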